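import Literature.MathematicalPhysics.QuantumFieldTheory.Balaban1983to89.TreeLengthDichotomy
import Literature.MathematicalPhysics.QuantumFieldTheory.Balaban1983to89.B14BoxFix

/-!
# `Balaban1983to89.B16StoppingRule` — the conditions (i), (ii) of [IV] and the stopping rule «K ≦ n₀ − j + R_j» of
[Balaban1989LargeFieldII] p. 385 in the ℤᵈ index model of the operation `S` (cell `STEP.md` §11 row O-F1, residual `hstop`)

CITATION HEADER (lean-in-tree rule 2026-08-18).  Passages served (renders of the cell folder `b2b-balaban-ref1/pages/`
READ AS IMAGES by the typist, unit b2b-balaban-b02 gen 9): T. Bałaban, *Large field renormalization. I. The basic step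
of the R operation*, Commun. Math. Phys. **122**, 175–202 (1989) [Balaban1989LargeFieldI] (cell paper B15 = [IV]),
p. 177 [PDF 3] (`…1989-cmp122-large-field-I-p003-x2.png`), verbatim: *"we consider the class of components such that
each satisfies the following two properties: (i) it is contained in a cube of the size 100 MR_k, (ii) in the preceding N
renormalization steps no new large field regions were created inside this component, and the previous regions contained
in it satisfy the condition (i) on the corresponding scales."*; T. Bałaban, *Large field renormalization. II*, Commun.
Math. Phys. **122**, 355–392 (1989) [Balaban1989LargeFieldII] (cell paper B16), p. 381 [PDF 27] (`…-II-p027-x2.png`):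
*"These factors are connected with components of a large field region Z_j, which satisfies the conditions (i), (ii) at
the beginning of Sect. 1 [IV]."* and *"for some m satisfying j − N ≦ m ≦ j"*; p. 384 [PDF 30] (`…-II-p030-x2.png`):
*"The factor exp(−κ_j(Z)) controls K renormalization steps, under the assumption that no large fields are created in
these steps, where the number K is the smallest positive integer having the property that the domain S^K(Z), considered
as a domain in the lattice of the scale L^{−(j+K)}, satisfies the conditions (i), (ii), with N = R_j."*; p. 385 [PDF 31]
(`…-II-p031-x2.png`), ll. 2–6: *"Consider now the sum in (1.80). Let n₀ be the last index n such that d′_n(Z^{(n−j)}) > 0.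
Then S^{n₀+1−j}(Z) is contained in a cube of the size 64MR_{n₀+1}, hence it satisfies the condition (i), and doing at
most R_j further steps we obtain a domain satisfying both conditions (i), (ii). Thus K ≦ n₀ − j + R_j, and we have"*
[(1.81), whose second sum runs over `n₀ + 1 ≦ n ≦ n₀ + R_j`].  Both papers are manuscripts UNDER ADJUDICATION by the
audit cell `pub-balaban`: NOTHING printed in them is asserted here; the quotations locate what the definitions below
TYPE and what the theorems below PROVE about the cell's model.  Every `theorem` is proved without `sorry` and without
new axioms over the EXISTING definitions `B16SProfile.{Siter, Qprod, ratio, DropCtl, box}` (the index model of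
`S(Z) = (Z′)^{~10}`, unit b02 gen 9), `TreeLength.treeLen` (the linear size `d_j`), `B13ScaleTransfer.{Pt, FaceConnected,
closureIdx}`, `TreeLengthDichotomy.Near` and `B14BoxFix.{FitsIn, ibox}` (unit pv02: the typed «contained in a cube of
the size 100MR_j» of [Balaban1988Convergent] (2.3)), using BY NAME `B16SProfile.Siter_subset_biUnion_box`,
`TreeLengthDichotomy.{near_of_treeLen_lt_one, subset_piFinset_of_near}`, `TreeLength.exists_admissible`,
`B13ScaleTransfer.faceConnected_closureIdx`, and for the end-to-end statement `B16SProfile.{exists_exponents,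
exists_threshold, dropCtl_of_27b, dropCtl_shift, majorant_181_of_flow}`.  NEW leaf module (unit b2b-balaban-b02, gen 9):
imports `…TreeLengthDichotomy`, `…B14BoxFix`; modifies nothing (`Step`, `StepInhabited` are the f2 lineage's files and
are untouched: the binder `hstop` of `Step.Budget.sum_le_third_181` / `controls_of_182` is served here in its exact
shape, to be consumed by name or not, at that lineage's option).

WHAT IS TYPED (Part 1).  `CondI Nsz X := B14BoxFix.FitsIn Nsz ↑X` — condition (i) for a domain read as its finite set
`X ⊆ ℤᵈ` of `MR_k`-cube indices, size parameter `Nsz` (print `100`).  Condition (ii) has a clause this model does not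
carry — «no new large field regions were created inside this component» is an event of the expansion, not geometry — so
it enters as a PARAMETER predicate `Clean : ℕ → Prop` on the steps after the creation scale, and p. 384's standing
assumption «under the assumption that no large fields are created in these steps» as the HYPOTHESIS
`∀ l, 1 ≤ l → l ≤ m → Clean l`; the geometric clause is (i) at the inspected scales.  WHICH scales «the preceding N
renormalization steps» inspect is typed in TWO READINGS, both over a sequence of domains `X l` (`X l = S^l(Z)`, `l`
relative to the creation scale): `CondII` (INCLUSIVE: the `N` scales `K − N + 1, …, K`, all post-creation, `N ≤ K`) and
`CondII'` (the window `[K − N, K − 1]` strictly before `K`, `N + 1 ≤ K` — with (i) at `K` itself this is the `N + 1`-scale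
window «j − N ≦ m ≦ j» of p. 381).  `StopAt` / `StopAt'` = «positive integer having the property that the domain S^K(Z)
… satisfies the conditions (i), (ii)» in the two readings; print's `K` is `Nat.find` of it.

WHAT IS PROVED.  Part 2 (`condI_64_of_lt_one`): for `L ≥ 3` under the drop control `DropCtl σ m` of the size exponents,
at EVERY relative scale `i ≤ m` whose cover `Z^{(i)}` has linear size `< 1` the iterate `S^{i}(Z)` fits in a cube of
`64` cube indices per side (`63 + 1`: the `□₀^{~31}` of p. 384 around pairwise touching cover cubes) — the sentence «Then
S^{n₀+1−j}(Z) is contained in a cube of the size 64MR_{n₀+1}» for all later scales at once; hence (i) with `100`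
(`condI_of_lt_one`).  Part 3: given the threshold property of the profile (`d′(Z^{(i)}) < 1` for `i₀ < i ≤ m`,
`B16SProfile.exists_threshold`), cleanliness after the creation scale, `Nsz ≥ 64`, `N ≥ 1`: the stopping property holds
at `i₀ + N` (inclusive reading, `stopAt_threshold`, needs `i₀ + N ≤ m`) and at `i₀ + N + 1` (window reading,
`stopAt'_threshold`), so the least stopping index is `≤ i₀ + N` (`find_stopAt_le` — print's «K ≦ n₀ − j + R_j» with
`i₀ = n₀ − j`, `N = R_j`), resp. `≤ i₀ + N + 1` (`find_stopAt'_le` — ONE MORE than printed: cell `DIVERGENCE.md`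
D-b02g9.4; the inclusive reading is the one that reproduces both «K ≦ n₀ − j + R_j» and the upper index `n₀ + R_j` of
(1.81)), and it is `≥ N` (`find_stopAt_spec`).  Part 4: the binder shape of `StepInhabited` Part M — `j + K ≤ n₀ + N` for
`K = Nat.find …` in absolute indices (`hstop_of_threshold`) — and the END-TO-END statement from the flow of
[Balaban1988Convergent] §2 (`majorant_181_and_stop_of_B14`): under exactly the hypotheses of
`B16SProfile.majorant_181_of_B14`, ONE threshold scale `n₀` serves both the second-to-third bound of (1.81) for every
tail (`hmid` of `Step.Budget.controls_of_182`) and the stopping property at `n₀ − j + N` for every `Nsz ≥ 64`, `N ≥ 1`,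
`Clean` holding after the creation scale, `n₀ + N ≤ K`.

WHAT IS NOT CLAIMED.  (a) That the cell's `Clean` is inhabited by the expansion's actual large-field history, or that
«at most R_j further steps» is the right count for the construction of [IV] — the large-field clause of (ii) is a
parameter here and the two typed windows differ by one step (D-b02g9.4); (b) the horizon: every statement lives inside
the flow horizon of [Balaban1988Convergent] (2.5)–(2.9) (`m`, resp. `K`), exactly as `B16SProfile`; a flow ending before
`n₀ + R_j` is the case `r < R_j` of `Step.Budget.sum_le_third_181`, not a stopping index; (c) minimality of `K` is
`Nat.find`'s, over a decidability instance supplied by the consumer (classically `Classical.decPred _`); (d) nothing about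
the R-operation of [IV] itself, the «rectangular parallelepipeds» remark of p. 177, or the conditions on `N` «formulated
in constructions of this section» — only the count `K ≦ n₀ − j + N` in the index model.  Cell records: `GAPS.md`
C-b02g9-5 / G-b02g9-4, `DIVERGENCE.md` D-b02g9.4, `STEP.md` §11 row O-F1 (owner f2: status change at their option).
-/

namespace Literature.MathematicalPhysics.QuantumFieldTheory.Balaban1983to89.B16StoppingRule

open Literature.MathematicalPhysics.QuantumFieldTheory.Balaban1983to89
open Literature.MathematicalPhysics.QuantumFieldTheory.Balaban1983to89.B13ScaleTransfer
open Literature.MathematicalPhysics.QuantumFieldTheory.Balaban1983to89.TreeLength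
open Literature.MathematicalPhysics.QuantumFieldTheory.Balaban1983to89.B16SProfile
open Literature.MathematicalPhysics.QuantumFieldTheory.Balaban1983to89.TreeLengthDichotomy

noncomputable section

variable {d : ℕ}

/-! ## Part 1. The conditions (i), (ii) of [Balaban1989LargeFieldI] p. 177 in the index model -/

/-- CONDITION (i) with size parameter `Nsz` (print: `100`): *"(i) it is contained in a cube of the size 100 MR_k"* — a
domain of the scale-`k` lattice, read as its finite set of `MR_k`-cube indices, fits in a cube of `Nsz` cube indices per
side; BY NAME the cell's `B14BoxFix.FitsIn` (the typed «contained in a cube of the size 100MR_j» of [Balaban1988Convergent]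
(2.3)). [cite: Balaban1989LargeFieldI, p.177 (condition (i))] -/
def CondI (Nsz : ℕ) (X : Finset (Pt d)) : Prop :=
  B14BoxFix.FitsIn Nsz (↑X : Set (Pt d))

/-- CONDITION (ii) with memory `N`, INCLUSIVE READING, for a sequence of domains `X 0, X 1, …` (`X l` = the domain at the
`l`-th scale after the creation scale, `X 0 = Z`) and a cleanliness predicate `Clean l` («no new large field regions were
created inside this component» at step `l` — NOT modelled geometrically: a parameter): at step `k` the `N` scales
`k − N + 1, …, k` are post-creation scales (`N ≤ k`), each clean, and each domain satisfies (i).  Print: *"(ii) in the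
preceding N renormalization steps no new large field regions were created inside this component, and the previous regions
contained in it satisfy the condition (i) on the corresponding scales."* [cite: Balaban1989LargeFieldI, p.177 (condition (ii))] -/
def CondII (Nsz N : ℕ) (Clean : ℕ → Prop) (X : ℕ → Finset (Pt d)) (k : ℕ) : Prop :=
  N ≤ k ∧ ∀ l, k < l + N → l ≤ k → Clean l ∧ CondI Nsz (X l)

/-- CONDITION (ii), EXCLUSIVE READING: the `N` scales `k − N, …, k − 1` strictly before `k` are post-creation
(`N + 1 ≤ k`), clean, and satisfy (i). [cite: Balaban1989LargeFieldI, p.177 (condition (ii))] -/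
def CondII' (Nsz N : ℕ) (Clean : ℕ → Prop) (X : ℕ → Finset (Pt d)) (k : ℕ) : Prop :=
  N + 1 ≤ k ∧ ∀ l, k ≤ l + N → l < k → Clean l ∧ CondI Nsz (X l)

/-- THE STOPPING PROPERTY of [Balaban1989LargeFieldII] p. 384 at `K` (inclusive reading of (ii)): *"the number K is the
smallest positive integer having the property that the domain S^K(Z), considered as a domain in the lattice of the scale
L^{−(j+K)}, satisfies the conditions (i), (ii), with N = R_j"* — `K > 0`, (i) for `X K`, (ii) at `K`.  The number `K` of
print is `Nat.find` of this predicate (Part 3). [cite: Balaban1989LargeFieldII, p.384 (definition of K)] -/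
def StopAt (Nsz N : ℕ) (Clean : ℕ → Prop) (X : ℕ → Finset (Pt d)) (K : ℕ) : Prop :=
  0 < K ∧ CondI Nsz (X K) ∧ CondII Nsz N Clean X K

/-- The stopping property with the exclusive reading of (ii). [cite: Balaban1989LargeFieldII, p.384 (definition of K)] -/
def StopAt' (Nsz N : ℕ) (Clean : ℕ → Prop) (X : ℕ → Finset (Pt d)) (K : ℕ) : Prop :=
  0 < K ∧ CondI Nsz (X K) ∧ CondII' Nsz N Clean X K

/-- (i) is monotone in the size parameter (`B14BoxFix.FitsIn.mono`). [folklore] -/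
theorem CondI.mono {Nsz Nsz' : ℕ} (h : Nsz ≤ Nsz') {X : Finset (Pt d)} (hX : CondI Nsz X) : CondI Nsz' X :=
  B14BoxFix.FitsIn.mono h hX

/-- A stopping index is at least the memory `N` (inclusive reading): the `N` inspected scales are post-creation. [folklore] -/
theorem le_of_stopAt {Nsz N : ℕ} {Clean : ℕ → Prop} {X : ℕ → Finset (Pt d)} {K : ℕ} (h : StopAt Nsz N Clean X K) :
    N ≤ K :=
  h.2.2.1

/-- A stopping index exceeds the memory `N` (exclusive reading). [folklore] -/
theorem lt_of_stopAt' {Nsz N : ℕ} {Clean : ℕ → Prop} {X : ℕ → Finset (Pt d)} {K : ℕ} (h : StopAt' Nsz N Clean X K) :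
    N < K :=
  h.2.2.1

/-- The exclusive reading at `K + 1` follows from the inclusive one at `K` plus (i) and cleanliness at `K + 1`. [folklore] -/
theorem stopAt'_succ_of_stopAt {Nsz N : ℕ} {Clean : ℕ → Prop} {X : ℕ → Finset (Pt d)} {K : ℕ}
    (h : StopAt Nsz N Clean X K) (hI : CondI Nsz (X (K + 1))) : StopAt' Nsz N Clean X (K + 1) := by
  obtain ⟨hK, -, hN, hall⟩ := h
  refine ⟨Nat.succ_pos K, hI, by omega, fun l h1 h2 => hall l (by omega) (by omega)⟩

/-! ## Part 2. Past the threshold every iterate fits in a cube of 64 cubes per side -/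

/-- *"Then S^{n₀+1−j}(Z) is contained in a cube of the size 64MR_{n₀+1}"* — KERNEL-CHECKED in the index model for EVERY
scale past the threshold: if the cover `Z^{(i)}` has linear size `< 1` (equivalently `= 0`: its cubes pairwise touch,
`TreeLengthDichotomy.near_of_treeLen_lt_one`), then `S^{i}(Z) ⊆ ⋃_{□₀ ⊂ Z^{(i)}} □₀^{~31}` (`B16SProfile.Siter_subset_biUnion_box`,
`L ≥ 3`, under the drop control) lies in a cube of `63 + 1 = 64` cube indices per side. [cite: Balaban1989LargeFieldII, p.385 l.2-3] -/
theorem condI_64_of_lt_one {L : ℕ} {σ : ℕ → ℕ} {m i : ℕ} (hL : 3 ≤ L) (h : DropCtl σ m)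
    {Z : Finset (Pt d)} (hZ : Z.Nonempty) (hZc : FaceConnected Z) (hi : i ≤ m)
    (ht : treeLen (closureIdx (Qprod (ratio L σ) i) Z) < 1) :
    CondI 64 (Siter (ratio L σ) i Z) := by
  set C := closureIdx (Qprod (ratio L σ) i) Z with hC
  have hCne : C.Nonempty := closureIdx_nonempty hZ
  have hCc : FaceConnected C := faceConnected_closureIdx (Qprod_pos (fun l => ratio_pos (by omega) σ l) i) hZc
  obtain ⟨T, hT, -⟩ := exists_admissible hCne hCc
  have hnear : Near C := near_of_treeLen_lt_one ⟨T, hT⟩ ht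
  have hpi := subset_piFinset_of_near hCne hnear
  refine ⟨fun μ => C.inf' hCne (fun x => x μ) - 31, ?_⟩
  intro y hy
  have hy' : y ∈ C.biUnion fun c => box c 31 := Siter_subset_biUnion_box hL h Z hi (Finset.mem_coe.mp hy)
  obtain ⟨c, hc, hyc⟩ := Finset.mem_biUnion.mp hy'
  have hcμ := Fintype.mem_piFinset.mp (hpi hc)
  intro μ
  have h1 := (mem_box.mp hyc) μ
  have h2 := hcμ μ
  rw [Finset.mem_insert, Finset.mem_singleton] at h2
  push_cast
  constructor <;> omega

/-- Hence condition (i) (`100` cubes per side) for every iterate past the threshold. [cite: Balaban1989LargeFieldII, p.385 l.2-3] -/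
theorem condI_of_lt_one {L : ℕ} {σ : ℕ → ℕ} {m i : ℕ} (hL : 3 ≤ L) (h : DropCtl σ m)
    {Z : Finset (Pt d)} (hZ : Z.Nonempty) (hZc : FaceConnected Z) (hi : i ≤ m)
    (ht : treeLen (closureIdx (Qprod (ratio L σ) i) Z) < 1) :
    CondI 100 (Siter (ratio L σ) i Z) :=
  (condI_64_of_lt_one hL h hZ hZc hi ht).mono (by norm_num)

/-! ## Part 3. *"doing at most R_j further steps we obtain a domain satisfying both conditions (i), (ii). Thus K ≤ n₀ − j + R_j"* -/

/-- THE STOPPING PROPERTY HOLDS AT `i₀ + N` (relative indices; inclusive reading of (ii)): past the threshold `i₀` every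
iterate satisfies (i) (Part 2), the steps after the creation scale are clean by the standing assumption of p. 384 (*"under
the assumption that no large fields are created in these steps"*), so at step `i₀ + N` the `N` scales `i₀ + 1, …, i₀ + N`
are post-creation, clean and satisfy (i) — for any size parameter `Nsz ≥ 64`, any memory `N ≥ 1`, inside the horizon
(`i₀ + N ≤ m`). [cite: Balaban1989LargeFieldII, p.385 l.3-5] -/
theorem stopAt_threshold {Nsz N L : ℕ} {σ : ℕ → ℕ} {m : ℕ} (hNsz : 64 ≤ Nsz) (hN : 1 ≤ N) (hL : 3 ≤ L)
    (h : DropCtl σ m) {Z : Finset (Pt d)} (hZ : Z.Nonempty) (hZc : FaceConnected Z) (i₀ : ℕ)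
    (hB : ∀ i, i₀ < i → i ≤ m → treeLen (closureIdx (Qprod (ratio L σ) i) Z) < 1)
    (Clean : ℕ → Prop) (hclean : ∀ l, 1 ≤ l → l ≤ m → Clean l) (hm : i₀ + N ≤ m) :
    StopAt Nsz N Clean (fun i => Siter (ratio L σ) i Z) (i₀ + N) := by
  refine ⟨by omega, ?_, by omega, fun l h1 h2 => ⟨hclean l (by omega) (by omega), ?_⟩⟩
  · exact (condI_64_of_lt_one hL h hZ hZc hm (hB _ (by omega) hm)).mono hNsz
  · exact (condI_64_of_lt_one hL h hZ hZc (by omega) (hB l (by omega) (by omega))).mono hNsz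

/-- The same with the EXCLUSIVE reading of (ii), one step later: the stopping property holds at `i₀ + N + 1`
(`i₀ + N + 1 ≤ m`). [cite: Balaban1989LargeFieldII, p.385 l.3-5] -/
theorem stopAt'_threshold {Nsz N L : ℕ} {σ : ℕ → ℕ} {m : ℕ} (hNsz : 64 ≤ Nsz) (hN : 1 ≤ N) (hL : 3 ≤ L)
    (h : DropCtl σ m) {Z : Finset (Pt d)} (hZ : Z.Nonempty) (hZc : FaceConnected Z) (i₀ : ℕ)
    (hB : ∀ i, i₀ < i → i ≤ m → treeLen (closureIdx (Qprod (ratio L σ) i) Z) < 1)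
    (Clean : ℕ → Prop) (hclean : ∀ l, 1 ≤ l → l ≤ m → Clean l) (hm : i₀ + N + 1 ≤ m) :
    StopAt' Nsz N Clean (fun i => Siter (ratio L σ) i Z) (i₀ + N + 1) :=
  stopAt'_succ_of_stopAt (stopAt_threshold hNsz hN hL h hZ hZc i₀ hB Clean hclean (by omega))
    ((condI_64_of_lt_one hL h hZ hZc hm (hB _ (by omega) hm)).mono hNsz)

/-- *"Thus K ≤ n₀ − j + R_j"* — THE NUMBER `K` OF P. 384 (the least index with the stopping property, `Nat.find`) is at
most `i₀ + N` in relative indices (`i₀ = n₀ − j`, `N = R_j`; inclusive reading of (ii)). [cite: Balaban1989LargeFieldII, p.385 l.5 (K ≤ n₀ − j + R_j)] -/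
theorem find_stopAt_le {Nsz N L : ℕ} {σ : ℕ → ℕ} {m : ℕ} (hNsz : 64 ≤ Nsz) (hN : 1 ≤ N) (hL : 3 ≤ L)
    (h : DropCtl σ m) {Z : Finset (Pt d)} (hZ : Z.Nonempty) (hZc : FaceConnected Z) (i₀ : ℕ)
    (hB : ∀ i, i₀ < i → i ≤ m → treeLen (closureIdx (Qprod (ratio L σ) i) Z) < 1)
    (Clean : ℕ → Prop) (hclean : ∀ l, 1 ≤ l → l ≤ m → Clean l) (hm : i₀ + N ≤ m)
    [DecidablePred (StopAt Nsz N Clean (fun i => Siter (ratio L σ) i Z))]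
    (hex : ∃ K, StopAt Nsz N Clean (fun i => Siter (ratio L σ) i Z) K) :
    Nat.find hex ≤ i₀ + N :=
  Nat.find_le (stopAt_threshold hNsz hN hL h hZ hZc i₀ hB Clean hclean hm)

/-- Exclusive reading: the least stopping index is at most `i₀ + N + 1` — ONE MORE than print's «n₀ − j + R_j»
(cell `DIVERGENCE.md` D-b02g9.4). [cite: Balaban1989LargeFieldII, p.385 l.5 (K ≤ n₀ − j + R_j)] -/
theorem find_stopAt'_le {Nsz N L : ℕ} {σ : ℕ → ℕ} {m : ℕ} (hNsz : 64 ≤ Nsz) (hN : 1 ≤ N) (hL : 3 ≤ L)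
    (h : DropCtl σ m) {Z : Finset (Pt d)} (hZ : Z.Nonempty) (hZc : FaceConnected Z) (i₀ : ℕ)
    (hB : ∀ i, i₀ < i → i ≤ m → treeLen (closureIdx (Qprod (ratio L σ) i) Z) < 1)
    (Clean : ℕ → Prop) (hclean : ∀ l, 1 ≤ l → l ≤ m → Clean l) (hm : i₀ + N + 1 ≤ m)
    [DecidablePred (StopAt' Nsz N Clean (fun i => Siter (ratio L σ) i Z))]
    (hex : ∃ K, StopAt' Nsz N Clean (fun i => Siter (ratio L σ) i Z) K) :
    Nat.find hex ≤ i₀ + N + 1 :=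
  Nat.find_le (stopAt'_threshold hNsz hN hL h hZ hZc i₀ hB Clean hclean hm)

/-- `K` IS the smallest positive integer with the property: it has it, and no smaller index does (`Nat.find_spec`,
`Nat.find_min`); in particular `N ≤ K`. [folklore] -/
theorem find_stopAt_spec {Nsz N : ℕ} {Clean : ℕ → Prop} {X : ℕ → Finset (Pt d)}
    [DecidablePred (StopAt Nsz N Clean X)] (hex : ∃ K, StopAt Nsz N Clean X K) :
    StopAt Nsz N Clean X (Nat.find hex) ∧ (∀ K, K < Nat.find hex → ¬ StopAt Nsz N Clean X K) ∧
      N ≤ Nat.find hex :=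
  ⟨Nat.find_spec hex, fun _ hK => Nat.find_min hex hK, le_of_stopAt (Nat.find_spec hex)⟩

/-! ## Part 4. In the binder shape of `Step.Budget.sum_le_third_181` / `controls_of_182` (absolute indices) -/

/-- THE BINDER `hstop : j + K ≤ n₀ + R_j` OF `Step.Budget.sum_le_third_181` / `controls_of_182` (`StepInhabited` Part M),
DISCHARGED in the index model for `K` = the least stopping index (inclusive reading of (ii)), `n₀ = j + i₀` the threshold
scale, `R_j = N` the memory, GIVEN the profile's threshold property on the horizon, the standing no-new-large-fields
assumption after the creation scale, and room in the horizon (`n₀ + N ≤ j + m`). [cite: Balaban1989LargeFieldII, p.385 l.5 (K ≤ n₀ − j + R_j)] -/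
theorem hstop_of_threshold {Nsz N L : ℕ} {σ : ℕ → ℕ} {m : ℕ} (hNsz : 64 ≤ Nsz) (hN : 1 ≤ N) (hL : 3 ≤ L)
    (h : DropCtl σ m) {Z : Finset (Pt d)} (hZ : Z.Nonempty) (hZc : FaceConnected Z) (j n₀ : ℕ) (hj : j ≤ n₀)
    (hB : ∀ n, n₀ < n → n ≤ j + m → treeLen (closureIdx (Qprod (ratio L σ) (n - j)) Z) < 1)
    (Clean : ℕ → Prop) (hclean : ∀ l, 1 ≤ l → l ≤ m → Clean l) (hm : n₀ + N ≤ j + m)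
    [DecidablePred (StopAt Nsz N Clean (fun i => Siter (ratio L σ) i Z))]
    (hex : ∃ K, StopAt Nsz N Clean (fun i => Siter (ratio L σ) i Z) K) :
    j + Nat.find hex ≤ n₀ + N := by
  have hle := find_stopAt_le hNsz hN hL h hZ hZc (n₀ - j)
    (fun i h1 h2 => by
      have := hB (j + i) (by omega) (by omega)
      rwa [show j + i - j = i by omega] at this)
    Clean hclean (by omega) hex
  omega

/-- END TO END FROM THE FLOW OF [Balaban1988Convergent] §2 — the hypotheses of `B16SProfile.majorant_181_of_B14` verbatim
(size exponents from (2.5), drop control from (2.7b) and the located smallness, horizon `K`), NOTHING more: there are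
exponents `σ` and a threshold scale `n₀ ∈ [j, K]` such that (a) `R_n = L^{σ_n}`; (b), (c) the printed thresholds hold —
`d′ ≥ 1` on `(j, n₀]`, `d′ < 1` on `(n₀, K]` for the covers; (d) the second-to-third bound of (1.81) for every tail `r`
(these four are `majorant_181_of_B14`'s, re-derived from the same named ingredients so that ONE `n₀` serves both); and
(e) NEW: for every size parameter `Nsz ≥ 64`, memory `N ≥ 1` and cleanliness predicate holding after the creation scale,
the stopping property (inclusive (ii)) holds at the relative index `n₀ − j + N` whenever `n₀ + N ≤ K` — so the least
stopping index `K_stop` obeys `j + K_stop ≤ n₀ + N` (`hstop_of_threshold`).  The same `n₀` feeds `hmid` AND `hstop` of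
`Step.Budget.controls_of_182`. [cite: Balaban1989LargeFieldII, p.384-385 ((1.80), (1.81), K ≤ n₀ − j + R_j)] -/
theorem majorant_181_and_stop_of_B14 (b : Step.Budget.Consts) {L p K : ℕ} (hL : 4 ≤ L) {g : ℕ → ℝ}
    {γ β' β₀ : ℝ} (hI : Step.InInterval γ K g) (hγ1 : γ ≤ 1) (R : ℕ → ℕ)
    (hR : ∀ n, n ≤ K → B14.IsRj L p (g n) (R n)) (hbR : ∀ n, n ≤ K → b.R n = (R n : ℝ))
    (h29a : ∀ m n, m < n → n ≤ K → (R n : ℝ) ≤ L * R m) (h27 : B14.FlowIneq27 g β' β₀ p K)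
    (hΘ : ∀ m n, m < n → n ≤ K →
      (1 + (g n) ^ 2 * β' * ((n : ℝ) - m)) ^ β₀ ≤ (L : ℝ) ^ (max (n - m) 2 / 2))
    (hC : 0 ≤ b.C) (hM : 0 ≤ b.M) (Z : Finset (Pt d)) (hZ : Z.Nonempty) (hZc : FaceConnected Z)
    (j : ℕ) (hjK : j ≤ K) :
    ∃ (σ : ℕ → ℕ) (n₀ : ℕ), (∀ n, n ≤ K → R n = L ^ σ n) ∧ j ≤ n₀ ∧ n₀ ≤ K ∧
      (∀ n ∈ Finset.Ioc j n₀,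
        1 ≤ treeLen (closureIdx (Qprod (ratio L (fun i => σ (j + i))) (n - j)) Z)) ∧
      (∀ n ∈ Finset.Ioc n₀ K,
        treeLen (closureIdx (Qprod (ratio L (fun i => σ (j + i))) (n - j)) Z) < 1) ∧
      (∀ r, n₀ + r ≤ K →
        ∑ n ∈ Finset.Ioc j (n₀ + r), b.cost n (treeLen (Siter (ratio L (fun i => σ (j + i))) (n - j) Z)) ≤
          b.C * b.M ^ b.d * ((L : ℝ) ^ (b.d + 1) * b.R j ^ (b.d + 1)) *
            (10 * 126 ^ d * treeLen Z + 5 * 126 ^ d * r)) ∧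
      ∀ (Nsz N : ℕ) (Clean : ℕ → Prop), 64 ≤ Nsz → 1 ≤ N → (∀ l, 1 ≤ l → l ≤ K - j → Clean l) →
        n₀ + N ≤ K → StopAt Nsz N Clean (fun i => Siter (ratio L (fun i => σ (j + i))) i Z) (n₀ - j + N) := by
  have hL0 : 0 < L := by omega
  obtain ⟨σ, hσ⟩ := exists_exponents R hR
  obtain ⟨i₀, hi₀, hA, hB⟩ := exists_threshold hL0 (fun i => σ (j + i)) (K - j) hZ hZc
  have hRpow : ∀ n, n ≤ K → b.R n = (L : ℝ) ^ σ n := by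
    intro n hn
    rw [hbR n hn, (hσ n hn).1]
    push_cast
    rfl
  have h29 : Step.Budget.RStepLe b.R L K := by
    intro m n hmn hnK
    rw [hbR n hnK, hbR m (le_trans hmn.le hnK)]
    exact h29a m n hmn hnK
  have hdrop := dropCtl_of_27b (by omega) hI hγ1 R σ hσ h27 hΘ
  have hD : DropCtl (fun i => σ (j + i)) (K - j) := dropCtl_shift hdrop
  refine ⟨σ, j + i₀, fun n hn => (hσ n hn).1, by omega, by omega, ?_, ?_, ?_, ?_⟩
  · intro n hn
    have hn' := Finset.mem_Ioc.mp hn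
    exact hA (n - j) (by omega) (by omega)
  · intro n hn
    have hn' := Finset.mem_Ioc.mp hn
    exact hB (n - j) (by omega) (by omega)
  · intro r hr
    refine majorant_181_of_flow b L hL K j (j + i₀) r (by omega) hr σ hRpow h29 hdrop hC hM Z hZ hZc ?_ ?_
    · intro n hn
      have hn' := Finset.mem_Ioc.mp hn
      exact hA (n - j) (by omega) (by omega)
    · intro n hn
      have hn' := Finset.mem_Ioc.mp hn
      exact hB (n - j) (by omega) (by omega)
  · intro Nsz N Clean hNsz hN hclean hNK
    have := stopAt_threshold hNsz hN (by omega) hD hZ hZc i₀ (fun i h1 h2 => hB i h1 h2) Clean hclean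
      (show i₀ + N ≤ K - j by omega)
    rwa [show j + i₀ - j + N = i₀ + N by omega]

end

end Literature.MathematicalPhysics.QuantumFieldTheory.Balaban1983to89.B16StoppingRule
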